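import Literature.NumberTheory.EllipticCurves.ModularCurve
import Literature.NumberTheory.EllipticCurves.GlobalMinimalModel
import Literature.NumberTheory.EllipticCurves.GaloisAction
import Literature.NumberTheory.DiophantineGeometry.Conductor
import Literature.NumberTheory.DiophantineGeometry.TateAlgorithm
import Mathlib.NumberTheory.Padics.HeightOneSpectrum
import HarnessLib
import HarnessLib.Audit.Tags

/-!
# Candidates E-imc-10 / E-imc-10′: STARRED potentially-good additive types force `p ∣ deg φ₀`
# (`StarredDegreeDivisibility p` at `p ≥ 5`, valuation form; `StarredDegreeDivisibilityIrr p`, all primes,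
# Kodaira-symbol form with `E[p]` irreducible)
# — cell `bsd-f2-manin` (D-0131 (3) frontier: the Manin constant at additive primes). `@[conjecture]`
# leaf (NOTHING asserted; definitions only).

HONEST FRAMING. LENS = Iwasawa-main-conjecture / Hida-family reading (planner-of-record `bsd-f2-manin-imc`
g2, HOME `run/shared/lean/pub/bsd-f2-manin/MEMO-imc.md` §10), Props VERBATIM from HOME/imc/Sketch-imc-g2.lean
v3 (sha16 67903f81d6ef5b7a) with `IsLatticeOptimal` inlined (the lattice clause) and the sketch's
`IsStarredPotGoodAt W p` / `placeOf p` inlined as the disjunction over the tree's Tate-algorithm symbol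
`W.kodairaSymbolAt ((Rat.HeightOneSpectrum.primesEquiv (R := ℤ)).symm ⟨p, _⟩) ∈ {II*, III*, IV*}`
(the sketch's instance binder `[Fact p.Prime]` of 10′ is rendered as the explicit hypothesis `hp : p.Prime`).
Single-curve, pairing-free laws: an `X₀(N)`-optimal globally minimal curve (datum `D` at the conductor
level with the lattice clause) with STARRED potentially-good additive type at `p`.

THE ROWS. E-imc-10 (`p ≥ 5`, valuation form): `p² ∣ N`, `v_p j ≥ 0`, `v_p Δ_min ∈ {8, 9, 10}` (= IV*, III*,
II*) ⇒ `p ∣ deg φ_D`. E-imc-10′ (all primes, the BAND form at `p = 2, 3`): `p² ∣ N`, Kodaira symbol at `p`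
starred potentially good, `E[p]` irreducible ⇒ `p ∣ deg φ_D`. MANIN CONTENT (memo §10): through the tree's
Watkins identity `deg′·c²·u² = p·deg·c′²` for a commuting twist pair, `p ∤ deg φ₀(E*)` forces `p ∣ c(E)` for
the UNSTARRED optimal partner or a non-commuting class — E-imc-10 is the one-curve shadow of (Manin at `p`
for the partner) ∧ E-imc-9a / E-imc-5. BC5 WITNESS (memo §10; ecdata, optimal := Cremona #1 / 990h3):
E-imc-10 0 exceptions / 153 006 `(class, p)` incidences N < 4·10⁵ (CM and rational isogenies included;
FALSE for `I_n*`, meaningless for unstarred types); E-imc-10′ p = 2: 0 / 180 666 irreducible starred classes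
N < 5·10⁵ (binder NECESSARY: 55 exceptions, all IV*, f₂ = 2, rational 2-isogeny: 20a1, 52a1, 116c1, …),
p = 3: 0 / 107 185 (necessary: 27a1). Refuter verdicts: REF1 **E-imc-10 SURVIVES, E-imc-10′ SURVIVES**
2026-08-27T16:22Z (HOME/REFUTER-ref1.md §R5: re-verified by a second single-curve implementation to
N < 5·10⁵, 191 937 / 191 937; 10′ p = 3 tame III*: 50 730 / 50 730; controls fail massively); REF2 / planner's
own placement erratum (STATUS 15:50Z, memo §10(d′)): the `p = 2` clause of 10′ is IN PRINT — Calegari–Emerton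
2009 Thm 1 (tree fact `calegariEmerton_oddModularDegree`: `4 ∣ N ∧ E[2]` irreducible ⇒ `2 ∣ deg φ₀` for
every Kodaira type); the `27 ∣ N` clause is the cell's E-an-4b; E-imc-10 proper = `p ≥ 5` and the tame cell
`9 ∥ N`, III* — NOT in print.
-/

noncomputable section

open scoped MatrixGroups ModularForm

open CongruenceSubgroup WeierstrassCurve
  Literature.NumberTheory.EllipticCurves Literature.NumberTheory.EllipticCurves.ModularForms
  Literature.NumberTheory.DiophantineGeometry

namespace Summit.BirchSwinnertonDyer.Rank1Residual.ManinAdditive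

/-- **Candidate E-imc-10 `StarredDegreeDivisibility p` (cell bsd-f2-manin; a LAW, NOT in print as a law,
nothing asserted):** an `X₀(N)`-optimal globally minimal curve `W` (datum `D` at the conductor level with
the lattice clause) with `p ≥ 5`, `p² ∣ N`, potentially good reduction at `p` (`v_p j ≥ 0`) and STARRED
type (`v_p Δ_min ∈ {8, 9, 10}` = IV*, III*, II*) has `p ∣ deg φ_D`.
[cite: Watkins2002, §2.1 p. 491 (shape only: the Watkins identity behind the Manin content; the law is NOT
in print — cell bsd-f2-manin MEMO-imc.md §10, E-imc-10)] -/
@[conjecture] def StarredDegreeDivisibility (p : ℕ) : Prop :=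
  ∀ (W : WeierstrassCurve ℚ) [W.IsElliptic] [W.IsGloballyMinimal] [NeZero (W.conductorNorm ℤ)]
    (D : ModularParametrizationData W (W.conductorNorm ℤ)),
    p.Prime → 5 ≤ p → p ^ 2 ∣ W.conductorNorm ℤ →
    0 ≤ padicValRat p W.j →
    (padicValInt p W.minimalDiscriminantInt = 8 ∨ padicValInt p W.minimalDiscriminantInt = 9 ∨
      padicValInt p W.minimalDiscriminantInt = 10) →
    (∀ z ∈ D.L.lattice, ∃ w ∈ periodLattice D.f, z = D.c * w) → p ∣ D.modularDegree

/-- **Candidate E-imc-10′ `StarredDegreeDivisibilityIrr p` (cell bsd-f2-manin; all primes, Kodaira-symbol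
form — the band version at `p = 2, 3`; the `p = 2` clause is in print (Calegari–Emerton 2009), nothing
asserted):** an `X₀(N)`-optimal globally minimal curve `W` with `p² ∣ N`, Kodaira symbol at the place `(p)`
one of II*, III*, IV* (starred potentially good) and `E[p]` irreducible has `p ∣ deg φ_D`.
[cite: CalegariEmerton2008, Theorem 1 (arXiv:math/0503359 p. 2; gives the p = 2 clause; the clauses at
p = 3 and p ≥ 5 are NOT in print — cell bsd-f2-manin MEMO-imc.md §10, E-imc-10′)] -/
@[conjecture] def StarredDegreeDivisibilityIrr (p : ℕ) : Prop :=
  ∀ (W : WeierstrassCurve ℚ) [W.IsElliptic] [W.IsGloballyMinimal] [NeZero (W.conductorNorm ℤ)]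
    (D : ModularParametrizationData W (W.conductorNorm ℤ)) (hp : p.Prime),
    p ^ 2 ∣ W.conductorNorm ℤ →
    (W.kodairaSymbolAt ((Rat.HeightOneSpectrum.primesEquiv (R := ℤ)).symm ⟨p, hp⟩) = .IIstar ∨
      W.kodairaSymbolAt ((Rat.HeightOneSpectrum.primesEquiv (R := ℤ)).symm ⟨p, hp⟩) = .IIIstar ∨
      W.kodairaSymbolAt ((Rat.HeightOneSpectrum.primesEquiv (R := ℤ)).symm ⟨p, hp⟩) = .IVstar) →
    W.HasIrreducibleModPGaloisRep p →
    (∀ z ∈ D.L.lattice, ∃ w ∈ periodLattice D.f, z = D.c * w) → p ∣ D.modularDegree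

end Summit.BirchSwinnertonDyer.Rank1Residual.ManinAdditive

end
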